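import Summits.ResolutionOfSingularities.ResolutionOfSingularities.Theorems.FrobeniusLadderFInjectiveMacaulayficationFilteredChartSubst
import Mathlib.Algebra.MvPolynomial.NoZeroDivisors
import HarnessLib

/-!
# (F2b) The filtered chart isomorphism `ι♮ : C_v ≃ T₀` (crux `FInjectiveMacaulayfication`, §17 filtered engine G4♮)

Support file for crux stmt-ResolutionOfSingularities-15315 (`FrobeniusLadder.FInjectiveMacaulayfication`), §17 THE FILTERED
ENGINE G4♮ `stub_filteredChartClause` (skeleton v13 `45d06e4e`, CRUX-PLAN w45a v5/v6 §1.2 piece (F2); lead seat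
res-L1-w45a-lead-1, in the shape requested by res-L1-w45a-stub-4). [OURS · L1 W4.5a]

See `FilteredChartSubst` (F2a) for the setting. Here: `ψ = (s ↦ 1)` maps the degree-`0` subalgebra `T₀ ⊆ T′♮` INTO the chart
`C_v = R[I_N R/x̄_v^c]` (`substOne_mem_blowupAlgebra`, Veronese saturation), INJECTIVELY (`substOne_injective_of_degZero`:
a vanishing numerator twists into the prime `(f^h) ∌ s`), and ONTO it (`blowupAlgebra_le_range`: the generators have degree-`0`
preimages); `exists_filteredChartIso` packages `ι♮ = (ψ|_{T₀})⁻¹ : C_v ≃+* T₀` with `ι♮(x̄_v^c) = (X_v^c/1)·(s/1)^N`.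
No definitions, no named facts. [folklore]
-/

set_option linter.dupNamespace false

noncomputable section

open scoped LaurentPolynomial
open AddMonoidAlgebra LaurentPolynomial Literature.AlgebraicGeometry.Resolution

namespace Summit.ResolutionOfSingularities.ResolutionOfSingularities.Theorems.FInjectiveMacaulayfication.FilteredChartIso

open Summit.ResolutionOfSingularities.ResolutionOfSingularities.Theorems.FInjectiveMacaulayfication
open FilteredChartSubst

variable {k : Type} [Field k] {n : ℕ} (w : Fin n → ℕ)
variable (f : MvPolynomial (Fin n) k) (D : ℕ) (fh : MvPolynomial (Option (Fin n)) k)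
  (hfh : fh = ∑ b ∈ f.support, MvPolynomial.monomial
    (Finsupp.mapDomain some b + Finsupp.single none (Finsupp.weight w b - D)) (MvPolynomial.coeff b f))
  (hD0 : ∀ m < D, MvPolynomial.weightedHomogeneousComponent w m f = 0)

/-! ## `ψ = (s ↦ 1)` on the degree-zero subalgebra -/

section Main

variable (v : Fin n) (N c : ℕ) (hcN : c * w v = N)
  (hpow : ∀ (K : ℕ) (b : Fin n →₀ ℕ), K * N ≤ Finsupp.weight w b → (MvPolynomial.monomial b (1 : k) : MvPolynomial (Fin n) k) ∈
    (Ideal.span {m : MvPolynomial (Fin n) k | ∃ b : Fin n →₀ ℕ, N ≤ Finsupp.weight w b ∧ m = MvPolynomial.monomial b 1}) ^ K)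
  (β : Localization.Away (Ideal.Quotient.mk (Ideal.span {fh}) (MvPolynomial.X (some v)) ^ c) →+* (Localization.Away (Ideal.Quotient.mk (Ideal.span {fh}) (MvPolynomial.X (some v)) ^ c))[T;T⁻¹])
  (hβ : ∀ (φ : MvPolynomial (Option (Fin n)) k) (d : ℤ),
    MvPolynomial.IsWeightedHomogeneous (fun o : Option (Fin n) => o.elim (-1 : ℤ) (fun j => (w j : ℤ))) φ d →
    β (algebraMap _ _ (Ideal.Quotient.mk (Ideal.span {fh}) φ)) = single d (algebraMap _ _ (Ideal.Quotient.mk (Ideal.span {fh}) φ)))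
  (T₀ : Subalgebra k (Localization.Away (Ideal.Quotient.mk (Ideal.span {fh}) (MvPolynomial.X (some v)) ^ c))) (hT₀ : ∀ b, b ∈ T₀ ↔ β b = single 0 b)
  (ψ : Localization.Away (Ideal.Quotient.mk (Ideal.span {fh}) (MvPolynomial.X (some v)) ^ c) →+* Localization.Away (Ideal.Quotient.mk (Ideal.span {f}) (MvPolynomial.X v) ^ c))
  (hψmk : ∀ a : MvPolynomial (Option (Fin n)) k, ψ (algebraMap _ _ (Ideal.Quotient.mk (Ideal.span {fh}) a)) =
    MvPolynomial.aeval (fun o : Option (Fin n) => o.elim (1 : Localization.Away (Ideal.Quotient.mk (Ideal.span {f}) (MvPolynomial.X v) ^ c))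
      (fun j => algebraMap _ (Localization.Away (Ideal.Quotient.mk (Ideal.span {f}) (MvPolynomial.X v) ^ c)) (Ideal.Quotient.mk (Ideal.span {f}) (MvPolynomial.X j)))) a)
  (hψinv : ψ (IsLocalization.Away.invSelf (Ideal.Quotient.mk (Ideal.span {fh}) (MvPolynomial.X (some v)) ^ c)) = IsLocalization.Away.invSelf (Ideal.Quotient.mk (Ideal.span {f}) (MvPolynomial.X v) ^ c))

section
include hcN hpow hβ hT₀ hψmk hψinv

/-- **`ψ(T₀) ⊆ C_v`**: a degree-`0` element is a sum of monomial fractions `c X^e / X_v^{cj}` with `w·(e∘some) ≥ jN`, which `ψ`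
sends to `c x̄^{e∘some}/u^j ∈ R[I_N R/u]` by Veronese saturation (Stacks 052Q). [folklore] -/
theorem substOne_mem_blowupAlgebra {b : Localization.Away (Ideal.Quotient.mk (Ideal.span {fh}) (MvPolynomial.X (some v)) ^ c)} (hb : b ∈ T₀) : ψ b ∈ blowupAlgebra ((Ideal.span {m : MvPolynomial (Fin n) k | ∃ b : Fin n →₀ ℕ, N ≤ Finsupp.weight w b ∧ m = MvPolynomial.monomial b 1}).map (Ideal.Quotient.mk (Ideal.span {f}))) (Ideal.Quotient.mk (Ideal.span {f}) (MvPolynomial.X v) ^ c) := by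
  classical
  obtain ⟨j, a, rfl⟩ := exists_eq_mk_mul_invSelf_pow fh _ b
  rw [eq_sum_of_degZero w fh v N c hcN β hβ j a ((hT₀ _).mp hb), map_sum]
  refine Subalgebra.sum_mem _ fun e he => ?_
  rw [Finset.mem_filter] at he
  rw [map_mul, map_pow, hψmk, aeval_elim_one_monomial, hψinv]
  refine algebraMap_mul_invSelf_pow_mem_blowupAlgebra _ j ?_
  rw [← Ideal.map_pow]
  refine Ideal.mem_map_of_mem _ ?_
  rw [← mul_one (MvPolynomial.coeff e a), ← MvPolynomial.C_mul_monomial]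
  refine Ideal.mul_mem_left _ _ (hpow j e.some ?_)
  have h2 := he.2
  zify
  linarith

end

section
include hfh hD0 hcN hβ hT₀ hψmk hψinv

set_option maxHeartbeats 400000 in
/-- **`ψ` is injective on `T₀`**: if `ψ b = 0` for `b = Σ_e c_e X^e/X_v^{cj}` of degree `0`, then `P = Σ c_e X^{e∘some} ∈ (f)`,
and twisting `P = g f` by `X_j ↦ X_j s^{w_j}` gives `s^{jN}·(Σ c_e X^e) = g^tw s^D f^h ∈ (f^h)`; as `(f^h)` is prime and
`s ∉ (f^h)` (`s ∤ f^h`), the numerator lies in `(f^h)` and `b = 0`. [folklore] -/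
theorem substOne_eq_zero (hf0 : MvPolynomial.weightedHomogeneousComponent w D f ≠ 0) (hfprime : (Ideal.span {f}).IsPrime)
    (hfhprime : (Ideal.span {fh}).IsPrime) (hXne : Ideal.Quotient.mk (Ideal.span {f}) (MvPolynomial.X v) ≠ 0)
    {b : Localization.Away (Ideal.Quotient.mk (Ideal.span {fh}) (MvPolynomial.X (some v)) ^ c)} (hb : b ∈ T₀) (h0 : ψ b = 0) : b = 0 := by
  classical
  haveI := hfprime
  haveI : IsDomain (MvPolynomial (Fin n) k ⧸ Ideal.span {f}) := Ideal.Quotient.isDomain _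
  have hinjL : Function.Injective (algebraMap (MvPolynomial (Fin n) k ⧸ Ideal.span {f}) (Localization.Away (Ideal.Quotient.mk (Ideal.span {f}) (MvPolynomial.X v) ^ c))) :=
    IsLocalization.injective _ (powers_le_nonZeroDivisors_of_noZeroDivisors (pow_ne_zero c hXne))
  obtain ⟨j, a, rfl⟩ := exists_eq_mk_mul_invSelf_pow fh _ b
  have hdec := eq_sum_of_degZero w fh v N c hcN β hβ j a ((hT₀ _).mp hb)
  rw [hdec] at h0 ⊢
  rw [map_sum, Finset.sum_congr rfl (fun e _ => by rw [map_mul, map_pow, hψmk, aeval_elim_one_monomial, hψinv]),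
    ← Finset.sum_mul, ← map_sum, ← map_sum] at h0
  -- cancel the unit `(1/u)^j` and pull back to `R`
  have hunit : IsUnit (IsLocalization.Away.invSelf (S := Localization.Away (Ideal.Quotient.mk (Ideal.span {f}) (MvPolynomial.X v) ^ c)) (Ideal.Quotient.mk (Ideal.span {f}) (MvPolynomial.X v) ^ c) ^ j) :=
    (IsUnit.of_mul_eq_one (a := IsLocalization.Away.invSelf (S := Localization.Away (Ideal.Quotient.mk (Ideal.span {f}) (MvPolynomial.X v) ^ c)) (Ideal.Quotient.mk (Ideal.span {f}) (MvPolynomial.X v) ^ c)) _ (by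
      rw [mul_comm]; exact IsLocalization.Away.mul_invSelf _)).pow j
  rw [hunit.mul_left_eq_zero, ← map_zero (algebraMap (MvPolynomial (Fin n) k ⧸ Ideal.span {f}) (Localization.Away (Ideal.Quotient.mk (Ideal.span {f}) (MvPolynomial.X v) ^ c)))] at h0
  have hP := hinjL h0
  rw [Ideal.Quotient.eq_zero_iff_mem, Ideal.mem_span_singleton'] at hP
  obtain ⟨g, hg⟩ := hP
  -- twist the relation `g f = P`
  have htw := congrArg (MvPolynomial.aeval (fun j : Fin n => (MvPolynomial.X (some j) : MvPolynomial (Option (Fin n)) k) *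
    MvPolynomial.X none ^ (w j))) hg
  have hsumtw : ∑ e ∈ a.support.filter (fun e => (Finsupp.weight w e.some : ℤ) - e none - j * N = 0),
      MvPolynomial.aeval (fun j : Fin n => (MvPolynomial.X (some j) : MvPolynomial (Option (Fin n)) k) * MvPolynomial.X none ^ (w j))
        (MvPolynomial.monomial e.some (MvPolynomial.coeff e a)) =
      ∑ e ∈ a.support.filter (fun e => (Finsupp.weight w e.some : ℤ) - e none - j * N = 0),
        MvPolynomial.X none ^ (j * N) * MvPolynomial.monomial e (MvPolynomial.coeff e a) :=
    Finset.sum_congr rfl fun e he => by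
      rw [Finset.mem_filter] at he
      exact (twist_monomial_some w e (MvPolynomial.coeff e a) (j * N) (by have h2 := he.2; zify; linarith)).symm
  rw [map_mul, twist_f w f D fh hfh hD0, map_sum, hsumtw, ← Finset.mul_sum] at htw
  -- the numerator lies in the prime `(f^h)`
  have hmem : MvPolynomial.X none ^ (j * N) * ∑ e ∈ a.support.filter (fun e => (Finsupp.weight w e.some : ℤ) - e none - j * N = 0),
      MvPolynomial.monomial e (MvPolynomial.coeff e a) ∈ Ideal.span {fh} := by
    rw [← htw, ← mul_assoc]
    exact Ideal.mul_mem_left _ _ (Ideal.mem_span_singleton_self fh)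
  rcases hfhprime.mem_or_mem hmem with hs | hnum
  · exfalso
    have hs1 : (MvPolynomial.X none : MvPolynomial (Option (Fin n)) k) ∈ Ideal.span {fh} := hfhprime.mem_of_pow_mem _ hs
    rw [Ideal.mem_span_singleton] at hs1
    obtain ⟨r, hr, hcase⟩ := MvPolynomial.dvd_X_iff_exists.mp hs1
    rcases hcase with h | h
    · exact hfhprime.ne_top (Ideal.span_singleton_eq_top.mpr (h ▸ hr.map MvPolynomial.C))
    · exact FilteredReesCarrier.not_X_none_dvd_fh w D f fh hfh hD0 hf0 ⟨MvPolynomial.C r, by rw [h, MvPolynomial.smul_eq_C_mul, mul_comm]⟩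
  · rw [← Finset.sum_mul, ← map_sum, ← map_sum, Ideal.Quotient.eq_zero_iff_mem.mpr hnum, map_zero, zero_mul]

end

section
include hcN hβ hT₀ hψmk hψinv

/-- **`C_v ⊆ ψ(T₀)`**: the image of `T₀` is an `R`-subalgebra of `L` (`ā/1 = ψ(a(X_j s^{w_j})/1)`) containing the generators
`x̄^b/u = ψ(X^b s^{w·b−N}/X_v^c)` of the chart. [folklore] -/
theorem exists_preimage {y : Localization.Away (Ideal.Quotient.mk (Ideal.span {f}) (MvPolynomial.X v) ^ c)} (hy : y ∈ blowupAlgebra ((Ideal.span {m : MvPolynomial (Fin n) k | ∃ b : Fin n →₀ ℕ, N ≤ Finsupp.weight w b ∧ m = MvPolynomial.monomial b 1}).map (Ideal.Quotient.mk (Ideal.span {f}))) (Ideal.Quotient.mk (Ideal.span {f}) (MvPolynomial.X v) ^ c)) : ∃ b ∈ T₀, ψ b = y := by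
  classical
  -- the image of `T₀` as an `R`-subalgebra of `L`
  let S' : Subalgebra (MvPolynomial (Fin n) k ⧸ Ideal.span {f}) (Localization.Away (Ideal.Quotient.mk (Ideal.span {f}) (MvPolynomial.X v) ^ c)) :=
    { carrier := {y | ∃ b ∈ T₀, ψ b = y}
      mul_mem' := by
        rintro _ _ ⟨b, hb, rfl⟩ ⟨b', hb', rfl⟩
        exact ⟨b * b', T₀.mul_mem hb hb', map_mul ψ b b'⟩
      one_mem' := ⟨1, T₀.one_mem, map_one ψ⟩
      add_mem' := by
        rintro _ _ ⟨b, hb, rfl⟩ ⟨b', hb', rfl⟩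
        exact ⟨b + b', T₀.add_mem hb hb', map_add ψ b b'⟩
      zero_mem' := ⟨0, T₀.zero_mem, map_zero ψ⟩
      algebraMap_mem' := fun r => by
        obtain ⟨a, rfl⟩ := Ideal.Quotient.mk_surjective r
        refine ⟨algebraMap _ _ (Ideal.Quotient.mk (Ideal.span {fh}) (MvPolynomial.aeval (fun j : Fin n =>
          (MvPolynomial.X (some j) : MvPolynomial (Option (Fin n)) k) * MvPolynomial.X none ^ (w j)) a)),
          (hT₀ _).mpr (hβ _ 0 (twist_isWeightedHomogeneous_zero w a)), ?_⟩
        rw [hψmk, ← AlgHom.comp_apply, MvPolynomial.comp_aeval]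
        have hfun : (fun j : Fin n => MvPolynomial.aeval (fun o : Option (Fin n) => o.elim (1 : Localization.Away (Ideal.Quotient.mk (Ideal.span {f}) (MvPolynomial.X v) ^ c))
            (fun j => algebraMap _ (Localization.Away (Ideal.Quotient.mk (Ideal.span {f}) (MvPolynomial.X v) ^ c)) (Ideal.Quotient.mk (Ideal.span {f}) (MvPolynomial.X j))))
            ((MvPolynomial.X (some j) : MvPolynomial (Option (Fin n)) k) * MvPolynomial.X none ^ (w j))) =
            fun j : Fin n => algebraMap _ (Localization.Away (Ideal.Quotient.mk (Ideal.span {f}) (MvPolynomial.X v) ^ c)) (Ideal.Quotient.mk (Ideal.span {f}) (MvPolynomial.X j)) := by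
          funext j
          rw [map_mul, map_pow, MvPolynomial.aeval_X, MvPolynomial.aeval_X, Option.elim_some, Option.elim_none, one_pow, mul_one]
        rw [hfun]
        exact aeval_algebraMap_mk f _ a }
  suffices h : blowupAlgebra ((Ideal.span {m : MvPolynomial (Fin n) k | ∃ b : Fin n →₀ ℕ, N ≤ Finsupp.weight w b ∧ m = MvPolynomial.monomial b 1}).map (Ideal.Quotient.mk (Ideal.span {f}))) (Ideal.Quotient.mk (Ideal.span {f}) (MvPolynomial.X v) ^ c) ≤ S' from h hy
  refine Algebra.adjoin_le ?_
  rintro _ ⟨x, hxI, rfl⟩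
  rw [Ideal.mem_map_iff_of_surjective _ Ideal.Quotient.mk_surjective] at hxI
  obtain ⟨a', ha', rfl⟩ := hxI
  refine Submodule.span_induction ?_ ?_ ?_ ?_ ha'
  · rintro _ ⟨b, hb, rfl⟩
    -- the degree-0 preimage `X^b s^{w·b − N} / X_v^c`
    refine ⟨algebraMap _ _ (Ideal.Quotient.mk (Ideal.span {fh}) (MvPolynomial.monomial
        (Finsupp.mapDomain some b + Finsupp.single none (Finsupp.weight w b - N)) 1)) *
        IsLocalization.Away.invSelf (Ideal.Quotient.mk (Ideal.span {fh}) (MvPolynomial.X (some v)) ^ c) ^ 1, (hT₀ _).mpr ?_, ?_⟩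
    · rw [coaction_term w fh v N c hcN β hβ, some_carrierExponent, none_carrierExponent, Nat.cast_sub hb]
      congr 1
      ring
    · show ψ _ = _
      rw [map_mul, map_pow, hψmk, aeval_elim_one_monomial, hψinv, some_carrierExponent, pow_one]
  · exact ⟨0, T₀.zero_mem, by rw [map_zero, map_zero, map_zero, zero_mul]⟩
  · rintro x y - - hx hy
    rw [map_add, map_add, add_mul]
    exact S'.add_mem hx hy
  · rintro g x - hx
    rw [smul_eq_mul, map_mul, map_mul, mul_assoc]
    exact S'.mul_mem (S'.algebraMap_mem _) hx

end

end Main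

/-! ## The filtered chart isomorphism -/

section
include hfh hD0

set_option maxHeartbeats 800000 in
/-- **(F2) THE FILTERED CHART ISOMORPHISM `ι♮ : C_v ≃+* T₀`** for ANY coaction `β` on `T′♮` with the stated values on classes of
weighted homogeneous polynomials and the degree-`0` subalgebra `T₀` cut out by `β b = single 0 b`; `ι♮(x̄_v^c) = (X_v^c/1)·(s/1)^N`.
Hypotheses: `(f)` and `(f^h)` prime, `f₀ ≠ 0`, `x̄_v ≠ 0`, `N = c·w_v`, Veronese saturation. `ι♮ = (ψ|_{T₀})⁻¹`. [folklore] -/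
theorem exists_filteredChartIso (hf0 : MvPolynomial.weightedHomogeneousComponent w D f ≠ 0)
    (hfprime : (Ideal.span {f}).IsPrime) (hfhprime : (Ideal.span {fh}).IsPrime) (v : Fin n)
    (hXne : Ideal.Quotient.mk (Ideal.span {f}) (MvPolynomial.X v) ≠ 0) (N c : ℕ) (hcN : c * w v = N)
    (hpow : ∀ (K : ℕ) (b : Fin n →₀ ℕ), K * N ≤ Finsupp.weight w b → (MvPolynomial.monomial b (1 : k) : MvPolynomial (Fin n) k) ∈
      (Ideal.span {m : MvPolynomial (Fin n) k | ∃ b : Fin n →₀ ℕ, N ≤ Finsupp.weight w b ∧ m = MvPolynomial.monomial b 1}) ^ K)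
    (β : Localization.Away (Ideal.Quotient.mk (Ideal.span {fh}) (MvPolynomial.X (some v)) ^ c) →+* (Localization.Away (Ideal.Quotient.mk (Ideal.span {fh}) (MvPolynomial.X (some v)) ^ c))[T;T⁻¹])
    (hβ : ∀ (φ : MvPolynomial (Option (Fin n)) k) (d : ℤ),
      MvPolynomial.IsWeightedHomogeneous (fun o : Option (Fin n) => o.elim (-1 : ℤ) (fun j => (w j : ℤ))) φ d →
      β (algebraMap _ _ (Ideal.Quotient.mk (Ideal.span {fh}) φ)) = single d (algebraMap _ _ (Ideal.Quotient.mk (Ideal.span {fh}) φ)))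
    (T₀ : Subalgebra k (Localization.Away (Ideal.Quotient.mk (Ideal.span {fh}) (MvPolynomial.X (some v)) ^ c))) (hT₀ : ∀ b, b ∈ T₀ ↔ β b = single 0 b) :
    ∃ ι : blowupAlgebra ((Ideal.span {m : MvPolynomial (Fin n) k | ∃ b : Fin n →₀ ℕ, N ≤ Finsupp.weight w b ∧ m = MvPolynomial.monomial b 1}).map (Ideal.Quotient.mk (Ideal.span {f}))) (Ideal.Quotient.mk (Ideal.span {f}) (MvPolynomial.X v) ^ c) ≃+* T₀,
      ((ι (algebraMap _ _ (Ideal.Quotient.mk (Ideal.span {f}) (MvPolynomial.X v) ^ c)) : T₀) : Localization.Away (Ideal.Quotient.mk (Ideal.span {fh}) (MvPolynomial.X (some v)) ^ c)) =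
        algebraMap _ _ (Ideal.Quotient.mk (Ideal.span {fh}) (MvPolynomial.X (some v)) ^ c) * (algebraMap _ _ (Ideal.Quotient.mk (Ideal.span {fh}) (MvPolynomial.X none))) ^ N := by
  obtain ⟨ψ, hψmk, hψinv⟩ := exists_substOne w f D fh hfh v c
  have hmem : ∀ b : T₀, (ψ.comp (T₀.val : T₀ →+* Localization.Away (Ideal.Quotient.mk (Ideal.span {fh}) (MvPolynomial.X (some v)) ^ c))) b ∈ blowupAlgebra ((Ideal.span {m : MvPolynomial (Fin n) k | ∃ b : Fin n →₀ ℕ, N ≤ Finsupp.weight w b ∧ m = MvPolynomial.monomial b 1}).map (Ideal.Quotient.mk (Ideal.span {f}))) (Ideal.Quotient.mk (Ideal.span {f}) (MvPolynomial.X v) ^ c) := fun b =>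
    substOne_mem_blowupAlgebra w f fh v N c hcN hpow β hβ T₀ hT₀ ψ hψmk hψinv b.2
  have hinj : Function.Injective ((ψ.comp (T₀.val : T₀ →+* Localization.Away (Ideal.Quotient.mk (Ideal.span {fh}) (MvPolynomial.X (some v)) ^ c))).codRestrict (blowupAlgebra ((Ideal.span {m : MvPolynomial (Fin n) k | ∃ b : Fin n →₀ ℕ, N ≤ Finsupp.weight w b ∧ m = MvPolynomial.monomial b 1}).map (Ideal.Quotient.mk (Ideal.span {f}))) (Ideal.Quotient.mk (Ideal.span {f}) (MvPolynomial.X v) ^ c)) hmem) := by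
    intro x y hxy
    have h1 : ψ (x - y : T₀) = 0 := by
      have h := congrArg Subtype.val hxy
      change ψ x = ψ y at h
      rw [AddSubgroupClass.coe_sub, map_sub, h, sub_self]
    have h2 := substOne_eq_zero w f D fh hfh hD0 v N c hcN β hβ T₀ hT₀ ψ hψmk hψinv hf0 hfprime hfhprime hXne (x - y).2 h1
    rw [AddSubgroupClass.coe_sub, sub_eq_zero] at h2
    exact Subtype.ext h2
  have hsurj : Function.Surjective ((ψ.comp (T₀.val : T₀ →+* Localization.Away (Ideal.Quotient.mk (Ideal.span {fh}) (MvPolynomial.X (some v)) ^ c))).codRestrict (blowupAlgebra ((Ideal.span {m : MvPolynomial (Fin n) k | ∃ b : Fin n →₀ ℕ, N ≤ Finsupp.weight w b ∧ m = MvPolynomial.monomial b 1}).map (Ideal.Quotient.mk (Ideal.span {f}))) (Ideal.Quotient.mk (Ideal.span {f}) (MvPolynomial.X v) ^ c)) hmem) := by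
    intro y
    obtain ⟨b, hb, h⟩ := exists_preimage w f fh v N c hcN β hβ T₀ hT₀ ψ hψmk hψinv y.2
    exact ⟨⟨b, hb⟩, Subtype.ext h⟩
  refine ⟨(RingEquiv.ofBijective _ ⟨hinj, hsurj⟩).symm, ?_⟩
  -- the value on `u`: `ψ ((X_v^c/1)(s/1)^N) = u`
  have hmemU : algebraMap _ (Localization.Away (Ideal.Quotient.mk (Ideal.span {fh}) (MvPolynomial.X (some v)) ^ c)) (Ideal.Quotient.mk (Ideal.span {fh}) (MvPolynomial.X (some v)) ^ c) * (algebraMap _ _ (Ideal.Quotient.mk (Ideal.span {fh}) (MvPolynomial.X none))) ^ N ∈ T₀ := by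
    rw [hT₀, map_mul, map_pow β, coaction_U w fh v N c hcN β hβ,
      hβ (MvPolynomial.X none) (-1) (MvPolynomial.isWeightedHomogeneous_X k _ none), single_pow, single_mul_single]
    congr 1
    simp
  have hval : (ψ.comp (T₀.val : T₀ →+* Localization.Away (Ideal.Quotient.mk (Ideal.span {fh}) (MvPolynomial.X (some v)) ^ c))).codRestrict (blowupAlgebra ((Ideal.span {m : MvPolynomial (Fin n) k | ∃ b : Fin n →₀ ℕ, N ≤ Finsupp.weight w b ∧ m = MvPolynomial.monomial b 1}).map (Ideal.Quotient.mk (Ideal.span {f}))) (Ideal.Quotient.mk (Ideal.span {f}) (MvPolynomial.X v) ^ c)) hmem ⟨_, hmemU⟩ =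
      algebraMap _ (blowupAlgebra ((Ideal.span {m : MvPolynomial (Fin n) k | ∃ b : Fin n →₀ ℕ, N ≤ Finsupp.weight w b ∧ m = MvPolynomial.monomial b 1}).map (Ideal.Quotient.mk (Ideal.span {f}))) (Ideal.Quotient.mk (Ideal.span {f}) (MvPolynomial.X v) ^ c)) (Ideal.Quotient.mk (Ideal.span {f}) (MvPolynomial.X v) ^ c) := by
    apply Subtype.ext
    show ψ (algebraMap _ (Localization.Away (Ideal.Quotient.mk (Ideal.span {fh}) (MvPolynomial.X (some v)) ^ c)) (Ideal.Quotient.mk (Ideal.span {fh}) (MvPolynomial.X (some v)) ^ c) * (algebraMap _ _ (Ideal.Quotient.mk (Ideal.span {fh}) (MvPolynomial.X none))) ^ N) =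
      algebraMap _ (Localization.Away (Ideal.Quotient.mk (Ideal.span {f}) (MvPolynomial.X v) ^ c)) (Ideal.Quotient.mk (Ideal.span {f}) (MvPolynomial.X v) ^ c)
    have hU := hψmk (MvPolynomial.X (some v) ^ c)
    rw [map_pow (Ideal.Quotient.mk (Ideal.span {fh})), map_pow (MvPolynomial.aeval _), MvPolynomial.aeval_X, Option.elim_some] at hU
    rw [map_mul, map_pow ψ, hU, hψmk, MvPolynomial.aeval_X, Option.elim_none, one_pow, mul_one]
    exact (map_pow _ _ _).symm
  have h := (RingEquiv.ofBijective _ ⟨hinj, hsurj⟩).symm_apply_apply ⟨_, hmemU⟩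
  rw [RingEquiv.ofBijective_apply, hval] at h
  rw [h]

end

end Summit.ResolutionOfSingularities.ResolutionOfSingularities.Theorems.FInjectiveMacaulayfication.FilteredChartIso

end
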